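import Summits.QuantumFields.YangMills.Theses.ConvexGribovBody
import Summits.QuantumFields.YangMills.Theorems.ClusteringToYangMills.Negative.AdapterNonSoftness
import Summits.QuantumFields.YangMills.Theorems.HypercubicLimit.Negative.AllTimesGapFalse
import Summits.QuantumFields.YangMills.Theorems.HypercubicLimit.Negative.NonabelianLoadBearing

/-!
# `ContinuumLegGivenGap` — negative-side support: per-group burden, cosmetic thresholds,
# non-abelianness is load-bearing, the line's stubs (Q)/(N) in their exact shapes

Support file for crux `stmt-QuantumFields-8782`
(`Summit.QuantumFields.YangMills.Theses.ConvexGribovBody.ContinuumLegGivenGap`, twin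
`…Theses.SmallCircleAnchor.ContinuumLegGivenGap`), extracted from the standing disprover's work file
`Cruxes/ContinuumLegGivenGap/Disproof.lean` (cycle 1, §§1–3).  Tree objects only, nothing posited, no `def`:
the crux's hypothesis at one `(G, r)` ("GapHypAt": `∃ β₀ ∀ β ≥ β₀ ∃ m > 0 ∃ S₁ ∀ A B ∃ C ∀ S n, S₁ ≤ S →
n ≤ S → |corr| ≤ C e^{−m n}`), its conclusion at `G` ("Concl": the `YangMills` body) and the shapes of the
picked line's stubs are written out verbatim in every statement.

* `ec_of_threshold`: the volume threshold `S₁(β)` of the hypothesis is COSMETIC (a priori bound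
  `|corr| ≤ 2‖A‖∞‖B‖∞` on the finitely many tori below it) — so stmt-8782 is exactly the per-group form of
  stmt-9443 (`ClusteringToYangMills`), and the line's stub (Q) is exactly 9443's adapter per `(G, r)`.
* `exists_gapHyp_not_concl_of_not_continuumLegGivenGap`: the disproof burden — a refutation exhibits ONE
  compact simple `G` with the volume-uniform weak-coupling lattice gap in EVERY faithful `r` and no Clay
  witness.
* `latticeConnectedCorr_subsingleton`, `continuumLegGivenGap_false_without_nonabelian`: for the trivial
  gauge group the hypothesis HOLDS (all connected correlations vanish) and the conclusion FAILS (landed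
  `not_converges_and_twoPointNontrivial_of_subsingleton`), so the crux with `IsCompactSimpleLieGroup`
  weakened to "connected ∧ linear" is false (`G = PUnit`): non-abelianness is load-bearing, and the
  hypothesis does not by itself manufacture an interacting limit.
* `abstract_requantise_false`: the line's stub (Q) (`GapHypAt r → β-uniform shape`) in its THRESHOLD form
  is not a soft consequence of its hypothesis, the a priori bound and continuity in `β` (corollary of the
  landed `abstract_adapter_false`).
* `criticality_hypothesis_redundant`: in the line's stub (N) (`GapHypAt r → every admissible rate
  function → 0`) the hypothesis is redundant (an admissible rate function IS a `GapHypAt` witness): (N) is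
  hypothesis (2) of the hub stmt-8762 unconditionally. [folklore]
-/

noncomputable section

open scoped SchwartzMap
open Filter Topology MeasureTheory
open Literature.MathematicalPhysics.AQFT Literature.MathematicalPhysics.QuantumLattice
open Literature.MathematicalPhysics.QuantumFieldTheory
open Summit.QuantumFields.YangMills.Theses
open Summit.QuantumFields.YangMills.Theorems.HypercubicLimit.Negative
open Summit.QuantumFields.YangMills.Theorems.ClusteringToYangMills.Negative

namespace Summit.QuantumFields.YangMills.Theorems.ContinuumLegGivenGap.Negative

/-! ## Thresholds are cosmetic -/

section Threshold

variable {G : Type} [Group G] [TopologicalSpace G] [IsTopologicalGroup G] [CompactSpace G]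
  [MeasurableSpace G] [BorelSpace G]

/-- **Threshold removal at one coupling.** A volume-uniform clustering bound valid on the tori of
half-side `S ≥ S₁` extends to ALL tori at the same rate: below the threshold `n ≤ S < S₁`, so the a
priori bound gives `|corr| ≤ 2‖A‖∞‖B‖∞ e^{m S₁} e^{−m n}`.  Hence the crux's hypothesis at `(G, r, β)` is
stmt-9443's threshold-free one, verbatim. [folklore] -/
theorem ec_of_threshold (r : LatticeRep G) (β : ℝ) {m : ℝ} (hm : 0 < m) (S₁ : ℕ)
    (h : ∀ A B : YMSpecies G, ∃ C : ℝ, ∀ S n : ℕ, S₁ ≤ S → n ≤ S →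
      |latticeConnectedCorr r.ρ β (2 * S + 1) A.F B.F n| ≤ C * Real.exp (-(m * n))) :
    ∀ A B : YMSpecies G, ∃ C : ℝ, ∀ S n : ℕ, n ≤ S →
      |latticeConnectedCorr r.ρ β (2 * S + 1) A.F B.F n| ≤ C * Real.exp (-(m * n)) := by
  intro A B
  obtain ⟨C, hC⟩ := h A B
  obtain ⟨CA, hCA⟩ := A.bounded
  obtain ⟨CB, hCB⟩ := B.bounded
  have hCAB : 0 ≤ 2 * (CA * CB) :=
    le_trans (abs_nonneg _) (abs_latticeConnectedCorr_le r β (2 * 0 + 1) hCA hCB 0)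
  refine ⟨max C 0 + 2 * (CA * CB) * Real.exp (m * S₁), fun S n hn => ?_⟩
  have hE : 0 ≤ 2 * (CA * CB) * Real.exp (m * S₁) := mul_nonneg hCAB (Real.exp_pos _).le
  rcases le_or_gt S₁ S with hS | hS
  · calc |latticeConnectedCorr r.ρ β (2 * S + 1) A.F B.F n| ≤ C * Real.exp (-(m * n)) := hC S n hS hn
      _ ≤ (max C 0 + 2 * (CA * CB) * Real.exp (m * S₁)) * Real.exp (-(m * n)) :=
          mul_le_mul_of_nonneg_right (le_trans (le_max_left _ _) (le_add_of_nonneg_right hE))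
            (Real.exp_pos _).le
  · have hnS₁ : (n : ℝ) ≤ S₁ := by exact_mod_cast (le_of_lt (lt_of_le_of_lt hn hS))
    have hexp : 1 ≤ Real.exp (m * S₁) * Real.exp (-(m * n)) := by
      rw [← Real.exp_add, Real.one_le_exp_iff]
      nlinarith
    calc |latticeConnectedCorr r.ρ β (2 * S + 1) A.F B.F n| ≤ 2 * (CA * CB) * 1 := by
          rw [mul_one]; exact abs_latticeConnectedCorr_le r β (2 * S + 1) hCA hCB n
      _ ≤ 2 * (CA * CB) * (Real.exp (m * S₁) * Real.exp (-(m * n))) :=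
          mul_le_mul_of_nonneg_left hexp hCAB
      _ = (2 * (CA * CB) * Real.exp (m * S₁)) * Real.exp (-(m * n)) := by ring
      _ ≤ (max C 0 + 2 * (CA * CB) * Real.exp (m * S₁)) * Real.exp (-(m * n)) :=
          mul_le_mul_of_nonneg_right (le_add_of_nonneg_left (le_max_right _ _)) (Real.exp_pos _).le

end Threshold

/-! ## The disproof burden, per group -/

section Burden

-- buildfix 2026-08-19 (maintenance): `exists_gapHyp_not_concl_of_not_continuumLegGivenGap` REMOVED — its conclusion negates
-- the PRE-RE-TYPE YangMills body (no `sch.HasWeakCouplingLimit`); after the Statement re-type (p116790, 2026-08-16)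
-- `¬ ContinuumLegGivenGap` only negates the stronger re-typed body, so the recorded statement is no longer derivable.
-- The per-group threshold lemma `ec_of_threshold` and everything below are untouched.

end Burden

/-! ## Non-abelianness is load-bearing: the trivial gauge group -/

section Subsingleton

variable {G : Type} [Group G] [TopologicalSpace G] [IsTopologicalGroup G] [CompactSpace G]
  [MeasurableSpace G] [BorelSpace G]

/-- **For a one-element gauge group every connected torus correlation vanishes** (every observable is
deterministic; Wilson's measure is a probability measure). [folklore] -/
theorem latticeConnectedCorr_subsingleton [Subsingleton G] (r : LatticeRep G) (β : ℝ) (S : ℕ) [NeZero S]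
    (A B : LGConfig 4 G → ℝ) (n : ℕ) : latticeConnectedCorr r.ρ β S A B n = 0 := by
  haveI := isProbabilityMeasure_wilsonMeasure (d := 4) (L := S) r.ρ r.continuous β
  have hconst : ∀ (h : GaugeConfig 4 S G → ℝ) (U₀ : GaugeConfig 4 S G),
      ∫ U, h U ∂(wilsonMeasure (d := 4) (L := S) r.ρ β) = h U₀ := by
    intro h U₀
    have hc : (fun U => h U) = fun _ => h U₀ := funext fun U => congrArg h (Subsingleton.elim U U₀)
    rw [hc, integral_const, smul_eq_mul, probReal_univ, one_mul]
  set U₀ : GaugeConfig 4 S G := fun _ => 1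
  unfold latticeConnectedCorr
  rw [hconst (fun U => A (torusLift S U) * B (configShift (-Pi.single 0 (n : ℤ)) (torusLift S U))) U₀,
    hconst (fun U => A (torusLift S U)) U₀, hconst (fun U => B (torusLift S U)) U₀]
  have hB : B (configShift (-Pi.single 0 (n : ℤ)) (torusLift S U₀)) = B (torusLift S U₀) :=
    congrArg B (Subsingleton.elim _ _)
  rw [hB, sub_self]

omit [Group G] [TopologicalSpace G] [IsTopologicalGroup G] [CompactSpace G] [MeasurableSpace G]
  [BorelSpace G] in
/-- **`ContinuumLegGivenGap` is false without "non-abelian".**  Weakening `IsCompactSimpleLieGroup G` to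
"compact, connected, with a faithful continuous unitary representation" makes the statement FALSE: for
`G = PUnit` the hypothesis holds (rate `1`, threshold `0`, constant `0`: `latticeConnectedCorr_subsingleton`)
while the conclusion fails for EVERY scheme and every OS datum (`IsYangMillsFor` forces the curvature
two-point function to factorise on real off-diagonal tensors; real→complex bridge;
`not_converges_and_twoPointNontrivial_of_subsingleton`).  So any proof uses non-abelianness, and the
hypothesis alone does not manufacture an interacting limit (no renormalisations `c_k, m_k` fake
`IsNontrivial`). [folklore] -/
theorem continuumLegGivenGap_false_without_nonabelian :
    ¬ (∀ (G : Type) [Group G] [TopologicalSpace G] [IsTopologicalGroup G] [CompactSpace G],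
        ConnectedSpace G → Nonempty (LatticeRep G) →
          letI : MeasurableSpace G := borel G
          haveI : BorelSpace G := ⟨rfl⟩
          (∀ r : LatticeRep G, ∃ β₀ : ℝ, ∀ β : ℝ, β₀ ≤ β → ∃ m : ℝ, 0 < m ∧ ∃ S₁ : ℕ,
            ∀ A B : YMSpecies G, ∃ C : ℝ, ∀ S n : ℕ, S₁ ≤ S → n ≤ S →
              |latticeConnectedCorr r.ρ β (2 * S + 1) A.F B.F n| ≤ C * Real.exp (-(m * n))) →
          ∃ (r : LatticeRep G) (sch : SpeciesScheme (YMSpecies G)) (T : OSData (YMSpecies G) 4),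
            IsYangMillsFor r sch T ∧ T.IsNontrivial r.curvature ∧ T.IsNonGaussian r.curvature ∧
              ∃ Δ > 0, T.HasMassGap Δ ∧ HasLatticeMassGap r sch Δ) := by
  intro h
  letI : MeasurableSpace PUnit := borel PUnit
  haveI : BorelSpace PUnit := ⟨rfl⟩
  have hgap : ∀ r : LatticeRep PUnit, ∃ β₀ : ℝ, ∀ β : ℝ, β₀ ≤ β → ∃ m : ℝ, 0 < m ∧ ∃ S₁ : ℕ,
      ∀ A B : YMSpecies PUnit, ∃ C : ℝ, ∀ S n : ℕ, S₁ ≤ S → n ≤ S →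
        |latticeConnectedCorr r.ρ β (2 * S + 1) A.F B.F n| ≤ C * Real.exp (-(m * n)) :=
    fun r => ⟨0, fun β _ => ⟨1, one_pos, 0, fun A B => ⟨0, fun S n _ _ => by
      rw [latticeConnectedCorr_subsingleton r β (2 * S + 1) A.F B.F n, abs_zero, zero_mul]⟩⟩⟩
  obtain ⟨r, sch, T, hYM, hnt, -, -⟩ := h PUnit inferInstance ⟨punitRep⟩ hgap
  exact not_converges_and_twoPointNontrivial_of_subsingleton r sch T.schwinger hYM hnt

end Subsingleton

/-! ## The picked line's stubs in their exact shapes -/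

section Stubs

/-- **The line's stub (Q) (`GapHypAt r → β-uniform shape`, THRESHOLD form) is not soft.**  There is a
family of "pair correlations" `f j β S n` (pairs `j : ℕ`), a priori bounded by `2` and CONTINUOUS in the
coupling at each fixed `(j, S, n)`, which has the crux-hypothesis shape at EVERY coupling (per-β rate,
a volume threshold, per-pair constants) and yet violates the β-uniform shape (hypothesis (1) of
`CriticalContinuumLimit`) for every tail, every rate function and every threshold function.  Corollary of
`abstract_adapter_false` (whose family even has the threshold-free shape).  So (Q) cannot be proved from
its hypothesis, the a priori bound `|corr| ≤ 2‖A‖∞‖B‖∞` and continuity of the finite-volume Wilson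
expectations in `β`; β-regularity of the volume-uniform constants (reflection positivity / transfer
matrix: OS-norm constants; a countable uniform β-cover, `AdapterCover.uniformShape_of_cover`) is needed.
[folklore] -/
theorem abstract_requantise_false :
    ∃ f : ℕ → ℝ → ℕ → ℕ → ℝ, (∀ j β S n, |f j β S n| ≤ 2) ∧ (∀ j S n, Continuous fun β => f j β S n) ∧
      (∀ β : ℝ, ∃ m : ℝ, 0 < m ∧ ∃ S₁ : ℕ, ∀ j : ℕ, ∃ C : ℝ, ∀ S n : ℕ, S₁ ≤ S → n ≤ S →
        |f j β S n| ≤ C * Real.exp (-(m * n))) ∧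
      ¬ ∃ (β₁ : ℝ) (m : ℝ → ℝ) (S₀ : ℝ → ℕ), (∀ β : ℝ, β₁ ≤ β → 0 < m β) ∧
        ∀ j : ℕ, ∃ C : ℝ, ∀ β : ℝ, β₁ ≤ β → ∀ S n : ℕ, S₀ β ≤ S → n ≤ S →
          |f j β S n| ≤ C * Real.exp (-(m β * n)) := by
  obtain ⟨f, hb, hc, hH, hnU⟩ := abstract_adapter_false
  refine ⟨f, hb, hc, fun β => ?_, hnU⟩
  obtain ⟨m, hm, hj⟩ := hH β
  exact ⟨m, hm, 0, fun j => (hj j).imp fun C hC S n _ hn => hC S n hn⟩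

/-- **In the line's stub (N) the crux hypothesis is redundant.**  (N) reads: for every compact simple
`(G, r)` with the crux hypothesis, every rate function `m` admissible on a tail (`0 < m β` and the
volume-uniform bound at rate `m β`, β-dependent thresholds and constants) tends to `0` as `β → ∞`.  An
admissible rate function IS a witness of the crux hypothesis, so (N) is equivalent to the same statement
WITHOUT that hypothesis — hypothesis (2) of the hub `CriticalContinuumLimit` (stmt-8762) for all `(G, r)`,
unconditionally (for `SU(N)`: criticality `ξ(β) → ∞`, Chatterjee 2019 Problem 5.1's direction). [folklore] -/
theorem criticality_hypothesis_redundant :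
    (∀ (G : Type) [Group G] [TopologicalSpace G] [IsTopologicalGroup G] [CompactSpace G]
        [MeasurableSpace G] [BorelSpace G], IsCompactSimpleLieGroup G → ∀ r : LatticeRep G,
        (∃ β₀ : ℝ, ∀ β : ℝ, β₀ ≤ β → ∃ m : ℝ, 0 < m ∧ ∃ S₁ : ℕ, ∀ A B : YMSpecies G, ∃ C : ℝ,
          ∀ S n : ℕ, S₁ ≤ S → n ≤ S →
            |latticeConnectedCorr r.ρ β (2 * S + 1) A.F B.F n| ≤ C * Real.exp (-(m * n))) →
        ∀ (β₁ : ℝ) (m : ℝ → ℝ),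
          (∀ β : ℝ, β₁ ≤ β → 0 < m β ∧ (∃ S₀ : ℕ, ∀ A B : YMSpecies G, ∃ C : ℝ, ∀ S n : ℕ, S₀ ≤ S →
            n ≤ S → |latticeConnectedCorr r.ρ β (2 * S + 1) A.F B.F n| ≤ C * Real.exp (-(m β * n)))) →
          ∀ m₀ : ℝ, 0 < m₀ → ∀ᶠ β : ℝ in atTop, m β < m₀) ↔
    (∀ (G : Type) [Group G] [TopologicalSpace G] [IsTopologicalGroup G] [CompactSpace G]
        [MeasurableSpace G] [BorelSpace G], IsCompactSimpleLieGroup G → ∀ r : LatticeRep G,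
        ∀ (β₁ : ℝ) (m : ℝ → ℝ),
          (∀ β : ℝ, β₁ ≤ β → 0 < m β ∧ (∃ S₀ : ℕ, ∀ A B : YMSpecies G, ∃ C : ℝ, ∀ S n : ℕ, S₀ ≤ S →
            n ≤ S → |latticeConnectedCorr r.ρ β (2 * S + 1) A.F B.F n| ≤ C * Real.exp (-(m β * n)))) →
          ∀ m₀ : ℝ, 0 < m₀ → ∀ᶠ β : ℝ in atTop, m β < m₀) := by
  refine ⟨fun h G _ _ _ _ _ _ hG r β₁ m hadm => ?_, fun h G _ _ _ _ _ _ hG r _ => h G hG r⟩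
  exact h G hG r ⟨β₁, fun β hβ => ⟨m β, (hadm β hβ).1, (hadm β hβ).2⟩⟩ β₁ m hadm

end Stubs

end Summit.QuantumFields.YangMills.Theorems.ContinuumLegGivenGap.Negative

end
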